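import Literature.Analysis.FluidPDE.CriticalSpacesProofs
import Literature.Analysis.FluidPDE.BoundedRepresentative
import Literature.Analysis.UnboundedOperators.HeatKernelGaussianData
import Literature.Analysis.UnboundedOperators.HeatSemigroupLpProofs
import Literature.Analysis.FunctionSpaces.LittlewoodPaleyBernsteinProofs
import Literature.Analysis.FunctionSpaces.LittlewoodPaleyConvergenceProofs
import Mathlib.Analysis.Distribution.AEEqOfIntegralContDiff
import HarnessLib

/-!
# The caloric extension of a field represents the heat flow of its distribution

Analysis/FluidPDE proof file (no definitions, no named facts). For a real vector field
`u₀ : E → ℝ^ι` with tempered distribution `U₀` (`IsDistributionOf u₀ U₀`: `φ • u₀ ∈ L¹` and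
`U₀ φ = ∫ φ • u₀` for Schwartz `φ`) the caloric extension `heatExtension u₀ t = G_t ∗ u₀`
(`HeatKernel.lean`; an absolutely convergent integral at every point, since `u₀` is integrable
against Gaussians) represents the Fourier-multiplier heat flow `e^{tΔ}U₀`
(`TemperedDistribution.heatSemigroup`, symbol `e^{-4π²t|ξ|²}`) — the vector-field / tempered-datum
version of the tree's `heatSemigroup_toTemperedDistribution_Lp_holds` (the case `u₀ ∈ L^p`):

* `integral_smul_complexify_heatExtension_eq_heatSemigroup`: for `t > 0` and a continuous compactly supported
  real test `g`, `∫ g • (G_t ∗ u₀) = ⟨e^{tΔ}U₀, g⟩` (Fubini under the off-centre Gaussian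
  majorant `G_t(x - y) ≤ 2^{d/2}e^{‖x‖²/4t}G_{2t}(y)` of `HeatKernelGaussianData.lean`, and
  `⟨e^{tΔ}U₀, g⟩ = ⟨U₀, G_t ∗ g⟩`, the transpose of a Fourier multiplier with Gaussian symbol,
  `𝓕⁻¹e^{-4π²t|·|²} = G_t`);
* `isDistributionOf_heatExtension_of_eLpNormDistrib_lt_top'`: if moreover `‖e^{tΔ}U₀‖_{L^p} < ∞`
  (`1 ≤ p`), then `G_t ∗ u₀ ∈ L^p` and `IsDistributionOf (heatExtension u₀ t) (e^{tΔ}U₀)`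
  (a.e. identification with the `L^p` representative by Mathlib's
  `ae_eq_of_integral_contDiff_smul_eq`).

This is item (F1) of the decomposition of `exists_isBesovMildSolutionOn` (BCD Thm. 5.40): the
free evolution of a `Ḃ^{-1+3/p}_{p,q}` datum, known as a distribution, is the honest function
`G_t ∗ u₀` that the duality-form mild formulation and Kato's fixed point consume
(Stein–Weiss 1971, Ch. I, Thm. 1.18; Bahouri–Chemin–Danchin 2011, §2.1.2).

## References

* E. M. Stein, G. Weiss, *Introduction to Fourier Analysis on Euclidean Spaces* (1971), Ch. I,
  Thm. 1.18 and §3. [SteinWeiss1971]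
* H. Bahouri, J.-Y. Chemin, R. Danchin, *Fourier Analysis and Nonlinear PDE* (2011), §2.1.2.
  [BahouriCheminDanchin2011]
-/

noncomputable section

open MeasureTheory Set Function Filter FourierTransform
open _root_.Topology
open scoped SchwartzMap ENNReal NNReal Convolution

namespace Literature.Analysis.FluidPDE

variable {ι : Type*} [Fintype ι] {E : Type*} [NormedAddCommGroup E] [InnerProductSpace ℝ E]
  [FiniteDimensional ℝ E] [MeasurableSpace E] [BorelSpace E]

/-! ## Gaussian integrability and measurability of the caloric extension -/

/-- A field with a tempered distribution is integrable against every centred Gaussian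
`G_a`, `a > 0` (test with the Schwartz heat kernel; private copy of the statement
`IsDistributionOf.integrable_heatKernel_mul_norm` of `NSBoundedMildOseen.lean`, which sits above
heavy imports). [folklore] -/
private theorem IsDistributionOf.integrable_heatKernel_mul_norm' {u₀ : E → EuclideanSpace ℝ ι}
    {U : 𝓢'(E, EuclideanSpace ℂ ι)} (hU : IsDistributionOf u₀ U) {a : ℝ} (ha : 0 < a) :
    Integrable (fun y => UnboundedOperators.heatKernel a y * ‖u₀ y‖) volume := by
  have h := (hU (FunctionSpaces.heatKernelSchwartz E a)).1.norm
  refine h.congr (Eventually.of_forall fun y => ?_)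
  simp only [norm_smul, FunctionSpaces.heatKernelSchwartz_apply ha, Complex.norm_real,
    Real.norm_eq_abs, FunctionSpaces.EuclideanSpace.norm_complexify,
    abs_of_pos (UnboundedOperators.heatKernel_pos ha y)]

omit [Fintype ι] in
/-- The caloric extension of an a.e.-strongly-measurable field is a.e.-strongly measurable
(Fubini measurability of the convolution integral; private copy of the statement
`aestronglyMeasurable_heatExtension_of_aestronglyMeasurable` of `NSBoundedMildOseenRestart.lean`,
which sits above heavy imports). [folklore] -/
private theorem aestronglyMeasurable_heatExtension_aux {F : Type*} [NormedAddCommGroup F]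
    [NormedSpace ℝ F] {u₀ : E → F} (hu₀ : AEStronglyMeasurable u₀ volume) (t : ℝ) :
    AEStronglyMeasurable (UnboundedOperators.heatExtension u₀ t) volume :=
  ((UnboundedOperators.continuous_heatKernel t).aestronglyMeasurable.convolution_integrand
    (ContinuousLinearMap.lsmul ℝ ℝ) hu₀).integral_prod_right'

/-- `y ↦ G_t(x - y) • u₀(y)` is integrable for a measurable field integrable against centred
Gaussians (off-centre domination). [folklore] -/
theorem integrable_heatKernel_sub_smul {F : Type*} [NormedAddCommGroup F] [NormedSpace ℝ F]
    {u₀ : E → F} (hu₀ : AEStronglyMeasurable u₀ volume)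
    (hG : ∀ a : ℝ, 0 < a → Integrable (fun y => UnboundedOperators.heatKernel a y * ‖u₀ y‖) volume)
    {t : ℝ} (ht : 0 < t) (x : E) :
    Integrable (fun y => UnboundedOperators.heatKernel t (x - y) • u₀ y) volume := by
  refine (UnboundedOperators.integrable_heatKernel_sub_mul_norm hu₀ hG ht x).mono'
    (((UnboundedOperators.continuous_heatKernel t).comp
      (continuous_const.sub continuous_id)).aestronglyMeasurable.smul hu₀)
    (Eventually.of_forall fun y => ?_)
  rw [norm_smul, Real.norm_of_nonneg (UnboundedOperators.heatKernel_pos ht _).le]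

/-- The caloric extension in the reflected form `e^{tΔ}u₀(x) = ∫ G_t(x - y) u₀(y) dy`. [folklore] -/
theorem heatExtension_eq_integral_sub {F : Type*} [NormedAddCommGroup F] [NormedSpace ℝ F]
    (u₀ : E → F) (t : ℝ) (x : E) :
    UnboundedOperators.heatExtension u₀ t x = ∫ y, UnboundedOperators.heatKernel t (x - y) • u₀ y := by
  rw [UnboundedOperators.heatExtension, convolution_lsmul_swap]

/-- **Pointwise Gaussian bound of the caloric extension**: for `u₀` integrable against centred
Gaussians, `‖e^{tΔ}u₀(x)‖ ≤ 2^{d/2} e^{‖x‖²/(4t)} ∫ G_{2t}(y)‖u₀(y)‖ dy`. [folklore] -/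
theorem norm_heatExtension_le_of_integrable_heatKernel {F : Type*} [NormedAddCommGroup F]
    [NormedSpace ℝ F] {u₀ : E → F}
    (hG : ∀ a : ℝ, 0 < a → Integrable (fun y => UnboundedOperators.heatKernel a y * ‖u₀ y‖) volume)
    {t : ℝ} (ht : 0 < t) (x : E) :
    ‖UnboundedOperators.heatExtension u₀ t x‖ ≤
      (2 : ℝ) ^ ((Module.finrank ℝ E : ℝ) / 2) * Real.exp (‖x‖ ^ 2 / (4 * t)) *
        ∫ y, UnboundedOperators.heatKernel (2 * t) y * ‖u₀ y‖ := by
  rw [heatExtension_eq_integral_sub, ← integral_const_mul]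
  refine (norm_integral_le_integral_norm _).trans (integral_mono_of_nonneg
    (Eventually.of_forall fun y => norm_nonneg _) ((hG (2 * t) (by positivity)).const_mul _)
    (Eventually.of_forall fun y => ?_))
  show ‖UnboundedOperators.heatKernel t (x - y) • u₀ y‖ ≤
    (2 : ℝ) ^ ((Module.finrank ℝ E : ℝ) / 2) * Real.exp (‖x‖ ^ 2 / (4 * t)) *
      (UnboundedOperators.heatKernel (2 * t) y * ‖u₀ y‖)
  rw [norm_smul, Real.norm_of_nonneg (UnboundedOperators.heatKernel_pos ht _).le, ← mul_assoc]
  exact mul_le_mul_of_nonneg_right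
    (UnboundedOperators.heatKernel_sub_le_mul_heatKernel_two_mul ht x y) (norm_nonneg _)

/-- The caloric extension of a measurable field integrable against centred Gaussians is locally
integrable (measurable, and bounded on bounded sets by the Gaussian bound). [folklore] -/
theorem locallyIntegrable_heatExtension {F : Type*} [NormedAddCommGroup F] [NormedSpace ℝ F]
    {u₀ : E → F} (hu₀ : AEStronglyMeasurable u₀ volume)
    (hG : ∀ a : ℝ, 0 < a → Integrable (fun y => UnboundedOperators.heatKernel a y * ‖u₀ y‖) volume)
    {t : ℝ} (ht : 0 < t) :
    LocallyIntegrable (UnboundedOperators.heatExtension u₀ t) volume := by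
  have hmeas := aestronglyMeasurable_heatExtension_aux hu₀ t
  refine (locallyIntegrable_iff (μ := (volume : Measure E))).2 fun K hK => ?_
  obtain ⟨R, hR⟩ := hK.isBounded.subset_closedBall 0
  set I : ℝ := ∫ y, UnboundedOperators.heatKernel (2 * t) y * ‖u₀ y‖ with hI
  set M : ℝ := (2 : ℝ) ^ ((Module.finrank ℝ E : ℝ) / 2) * Real.exp (R ^ 2 / (4 * t)) * I with hM
  have hI0 : 0 ≤ I := integral_nonneg fun y =>
    mul_nonneg (UnboundedOperators.heatKernel_pos (by positivity) y).le (norm_nonneg _)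
  refine Measure.integrableOn_of_bounded (M := M) hK.measure_lt_top.ne hmeas ?_
  refine (ae_restrict_iff' hK.measurableSet).2 (Eventually.of_forall fun x hx => ?_)
  have hxR : ‖x‖ ≤ R := by simpa using hR hx
  calc ‖UnboundedOperators.heatExtension u₀ t x‖
      ≤ (2 : ℝ) ^ ((Module.finrank ℝ E : ℝ) / 2) * Real.exp (‖x‖ ^ 2 / (4 * t)) * I :=
        norm_heatExtension_le_of_integrable_heatKernel hG ht x
    _ ≤ M := by
        rw [hM]
        gcongr

/-! ## The pairing identity against compactly supported tests -/

/-- **`∫ g • (G_t ∗ u₀) = ⟨e^{tΔ}U₀, g⟩` for continuous compactly supported real `g`** (`t > 0`):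
the transpose of the Fourier multiplier `e^{tΔ}` acts on the test function by convolution with
`𝓕⁻¹e^{-4π²t|·|²} = G_t`, so `⟨e^{tΔ}U₀, g⟩ = ⟨U₀, G_t ∗ g⟩ = ∫ (G_t ∗ g) • u₀`
(`IsDistributionOf`), and Fubini — legitimate because `|g(x)| G_t(x - y) ‖u₀(y)‖` is dominated
by `C |g(x)| G_{2t}(y)‖u₀(y)‖` on the support of `g` — turns this into `∫ g • (G_t ∗ u₀)`
(Stein–Weiss 1971, Ch. I, Thm. 1.18). [folklore] -/
theorem integral_smul_complexify_heatExtension_eq_heatSemigroup {u₀ : E → EuclideanSpace ℝ ι}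
    {U₀ : 𝓢'(E, EuclideanSpace ℂ ι)} (hU₀ : IsDistributionOf u₀ U₀) {t : ℝ} (ht : 0 < t)
    {g : E → ℝ} (hg : Continuous g) (hgs : HasCompactSupport g) (θ : 𝓢(E, ℂ))
    (hθ : ∀ x, θ x = (g x : ℂ)) :
    ∫ x, g x • FunctionSpaces.EuclideanSpace.complexify (UnboundedOperators.heatExtension u₀ t x) =
      TemperedDistribution.heatSemigroup t U₀ θ := by
  have hmeas : AEStronglyMeasurable u₀ volume := hU₀.aestronglyMeasurable
  have hG : ∀ a : ℝ, 0 < a → Integrable (fun y => UnboundedOperators.heatKernel a y * ‖u₀ y‖) volume :=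
    fun a ha => hU₀.integrable_heatKernel_mul_norm' ha
  set cu : E → EuclideanSpace ℂ ι := fun y => FunctionSpaces.EuclideanSpace.complexify (u₀ y)
    with hcudef
  have hcum : AEStronglyMeasurable cu volume :=
    (FunctionSpaces.EuclideanSpace.complexify (ι := ι)).continuous.comp_aestronglyMeasurable hmeas
  -- ### the Gaussian symbol and kernel on the Schwartz side
  obtain ⟨Ψ, hΨ⟩ := UnboundedOperators.exists_schwartzMap_coe_eq_heatSymbol (E := E) ht
  have hK : ⇑(𝓕⁻ Ψ : 𝓢(E, ℂ)) = fun x : E => (UnboundedOperators.heatKernel t x : ℂ) :=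
    UnboundedOperators.coe_fourierInv_eq_heatKernel_of_coe_eq_heatSymbol ht hΨ
  have hFΨ : ∀ z : E, (𝓕 Ψ) z = (UnboundedOperators.heatKernel t z : ℂ) := by
    intro z
    have h1 := FunctionSpaces.fourierInv_apply_eq_fourier_neg Ψ (-z)
    rw [neg_neg] at h1
    rw [← h1, hK]
    simp only [UnboundedOperators.heatKernel, norm_neg]
  -- `⟨e^{tΔ}U₀, θ⟩ = ⟨U₀, Θ⟩`, `Θ = 𝓕(Ψ · 𝓕⁻¹θ) = G_t ∗ θ`
  set Θ : 𝓢(E, ℂ) := 𝓕 (SchwartzMap.smulLeftCLM ℂ (⇑Ψ) (𝓕⁻ θ)) with hΘdef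
  have hRHS : TemperedDistribution.heatSemigroup t U₀ θ = U₀ Θ := by
    rw [TemperedDistribution.heatSemigroup_eq_fourierMultiplierCLM, ← hΨ,
      TemperedDistribution.fourierMultiplierCLM_apply_apply]
  have hΘ : ∀ y : E, Θ y = ((∫ x, g x * UnboundedOperators.heatKernel t (x - y) : ℝ) : ℂ) := by
    intro y
    rw [hΘdef, FunctionSpaces.fourier_smulLeftCLM_fourierInv_apply_eq_integral Ψ θ y,
      ← integral_complex_ofReal]
    refine integral_congr_ae (Eventually.of_forall fun x => ?_)
    show θ x * (𝓕 Ψ) (y - x) = ((g x * UnboundedOperators.heatKernel t (x - y) : ℝ) : ℂ)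
    rw [hθ x, hFΨ, Complex.ofReal_mul]
    congr 2
    simp only [UnboundedOperators.heatKernel, norm_sub_rev]
  -- ### the joint integrand and Fubini
  set H : E → E → EuclideanSpace ℂ ι := fun x y =>
    (g x * UnboundedOperators.heatKernel t (x - y)) • cu y with hHdef
  obtain ⟨ρ, hρ⟩ := hgs.isCompact.isBounded.subset_closedBall 0
  set C : ℝ := (2 : ℝ) ^ ((Module.finrank ℝ E : ℝ) / 2) * Real.exp (ρ ^ 2 / (4 * t)) with hC
  have hdom : ∀ x y, ‖H x y‖ ≤ (C * ‖g x‖) * (UnboundedOperators.heatKernel (2 * t) y * ‖u₀ y‖) := by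
    intro x y
    by_cases hx : g x = 0
    · simp [hHdef, hx]
    · have hxρ : ‖x‖ ≤ ρ := by
        have : x ∈ tsupport g := subset_tsupport _ (Function.mem_support.2 hx)
        simpa using hρ this
      rw [hHdef]
      simp only [norm_smul, Real.norm_eq_abs, abs_mul,
        abs_of_pos (UnboundedOperators.heatKernel_pos ht _), hcudef,
        FunctionSpaces.EuclideanSpace.norm_complexify]
      have hk := UnboundedOperators.heatKernel_sub_le_mul_heatKernel_two_mul ht x y
      have hK2 : 0 ≤ UnboundedOperators.heatKernel (2 * t) y :=
        (UnboundedOperators.heatKernel_pos (by positivity) y).le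
      have hB : (2 : ℝ) ^ ((Module.finrank ℝ E : ℝ) / 2) * Real.exp (‖x‖ ^ 2 / (4 * t)) ≤ C := by
        rw [hC]; gcongr
      calc |g x| * UnboundedOperators.heatKernel t (x - y) * ‖u₀ y‖
          ≤ |g x| * ((2 : ℝ) ^ ((Module.finrank ℝ E : ℝ) / 2) * Real.exp (‖x‖ ^ 2 / (4 * t)) *
              UnboundedOperators.heatKernel (2 * t) y) * ‖u₀ y‖ := by gcongr
        _ ≤ |g x| * (C * UnboundedOperators.heatKernel (2 * t) y) * ‖u₀ y‖ :=
            mul_le_mul_of_nonneg_right (mul_le_mul_of_nonneg_left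
              (mul_le_mul_of_nonneg_right hB hK2) (abs_nonneg _)) (norm_nonneg _)
        _ = C * |g x| * (UnboundedOperators.heatKernel (2 * t) y * ‖u₀ y‖) := by ring
  have hHm : AEStronglyMeasurable (uncurry H) ((volume : Measure E).prod volume) := by
    have h1 : Continuous fun z : E × E => g z.1 * UnboundedOperators.heatKernel t (z.1 - z.2) :=
      (hg.comp continuous_fst).mul
        ((UnboundedOperators.continuous_heatKernel t).comp (continuous_fst.sub continuous_snd))
    exact h1.aestronglyMeasurable.smul hcum.comp_snd
  have hHint : Integrable (uncurry H) ((volume : Measure E).prod volume) := by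
    have hgi : Integrable (fun x => C * ‖g x‖) volume :=
      (hg.integrable_of_hasCompactSupport hgs).norm.const_mul C
    refine (hgi.mul_prod (hG (2 * t) (by positivity))).mono' hHm
      (Eventually.of_forall fun z => ?_)
    exact hdom z.1 z.2
  have hswap := integral_integral_swap hHint
  -- ### the inner integrals
  have hinner_x : ∀ x, ∫ y, H x y = g x • FunctionSpaces.EuclideanSpace.complexify
      (UnboundedOperators.heatExtension u₀ t x) := by
    intro x
    have hi : Integrable (fun y => UnboundedOperators.heatKernel t (x - y) • u₀ y) volume :=
      integrable_heatKernel_sub_smul hmeas hG ht x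
    have hcomm : FunctionSpaces.EuclideanSpace.complexify
        (∫ y, UnboundedOperators.heatKernel t (x - y) • u₀ y) =
        ∫ y, FunctionSpaces.EuclideanSpace.complexify (UnboundedOperators.heatKernel t (x - y) • u₀ y) := by
      exact ((FunctionSpaces.EuclideanSpace.complexify (ι := ι)).toContinuousLinearMap.integral_comp_comm
        hi).symm
    rw [heatExtension_eq_integral_sub, hcomm, ← integral_smul]
    refine integral_congr_ae (Eventually.of_forall fun y => ?_)
    show (g x * UnboundedOperators.heatKernel t (x - y)) • FunctionSpaces.EuclideanSpace.complexify (u₀ y) =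
      g x • FunctionSpaces.EuclideanSpace.complexify (UnboundedOperators.heatKernel t (x - y) • u₀ y)
    rw [map_smul, smul_smul]
  have hinner_y : ∀ y, ∫ x, H x y = Θ y • cu y := by
    intro y
    rw [hΘ y, Complex.coe_smul]
    show ∫ x, (g x * UnboundedOperators.heatKernel t (x - y)) • cu y = _
    rw [integral_smul_const]
  -- ### assembling
  calc ∫ x, g x • FunctionSpaces.EuclideanSpace.complexify (UnboundedOperators.heatExtension u₀ t x)
      = ∫ x, ∫ y, H x y := integral_congr_ae (Eventually.of_forall fun x => (hinner_x x).symm)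
    _ = ∫ y, ∫ x, H x y := hswap
    _ = ∫ y, Θ y • cu y := integral_congr_ae (Eventually.of_forall fun y => hinner_y y)
    _ = U₀ Θ := ((hU₀ Θ).2).symm
    _ = TemperedDistribution.heatSemigroup t U₀ θ := hRHS.symm

/-! ## The representation theorem -/

/-- **The caloric extension represents the heat flow of the distribution** (Stein–Weiss 1971,
Ch. I, Thm. 1.18; BCD §2.1.2): if `IsDistributionOf u₀ U₀`, `t > 0`, and `‖e^{tΔ}U₀‖_{L^p} < ∞`
(`1 ≤ p`), then `heatExtension u₀ t ∈ L^p` and its tempered distribution is `e^{tΔ}U₀`. Proof: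
`e^{tΔ}U₀` is the distribution of some `F ∈ L^p`; by `integral_smul_complexify_heatExtension_eq_heatSemigroup`,
`G_t ∗ u₀` (locally integrable) and `F` have the same integrals against smooth compactly
supported tests, hence agree a.e. (`ae_eq_of_integral_contDiff_smul_eq`). This is the statement
of the named fact `isDistributionOf_heatExtension_of_eLpNormDistrib_lt_top` of the
decomposition of `exists_isBesovMildSolutionOn`, in every dimension. [folklore] -/
theorem isDistributionOf_heatExtension_of_eLpNormDistrib_lt_top' {u₀ : E → EuclideanSpace ℝ ι}
    {U₀ : 𝓢'(E, EuclideanSpace ℂ ι)} (hU₀ : IsDistributionOf u₀ U₀) {p : ℝ≥0∞} [hp : Fact (1 ≤ p)]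
    {t : ℝ} (ht : 0 < t)
    (hfin : FunctionSpaces.eLpNormDistrib p (TemperedDistribution.heatSemigroup t U₀) < ∞) :
    IsDistributionOf (UnboundedOperators.heatExtension u₀ t)
        (TemperedDistribution.heatSemigroup t U₀) ∧
      MemLp (UnboundedOperators.heatExtension u₀ t) p volume := by
  have hmeas : AEStronglyMeasurable u₀ volume := hU₀.aestronglyMeasurable
  have hG : ∀ a : ℝ, 0 < a → Integrable (fun y => UnboundedOperators.heatKernel a y * ‖u₀ y‖) volume :=
    fun a ha => hU₀.integrable_heatKernel_mul_norm' ha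
  obtain ⟨FL, hFL⟩ := FunctionSpaces.exists_coe_eq_of_eLpNormDistrib_lt_top hfin
  set v : E → EuclideanSpace ℝ ι := UnboundedOperators.heatExtension u₀ t with hvdef
  set cv : E → EuclideanSpace ℂ ι := fun x => FunctionSpaces.EuclideanSpace.complexify (v x)
    with hcvdef
  -- local integrability of both sides
  have hv_loc : LocallyIntegrable v volume := locallyIntegrable_heatExtension hmeas hG ht
  have hcv_loc : LocallyIntegrable cv volume := by
    refine (locallyIntegrable_iff (μ := (volume : Measure E))).2 fun K hK => ?_
    have h := (locallyIntegrable_iff (μ := (volume : Measure E))).1 hv_loc K hK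
    exact (FunctionSpaces.EuclideanSpace.complexify (ι := ι)).toContinuousLinearMap.integrable_comp h
  have hFL_loc : LocallyIntegrable (FL : E → EuclideanSpace ℂ ι) volume :=
    (Lp.memLp FL).locallyIntegrable hp.out
  -- a.e. identification with the `L^p` representative
  have hae : cv =ᵐ[volume] (FL : E → EuclideanSpace ℂ ι) := by
    refine ae_eq_of_integral_contDiff_smul_eq hcv_loc hFL_loc fun g hg hgs => ?_
    have hcs : HasCompactSupport fun y => ((g y : ℝ) : ℂ) := hgs.comp_left Complex.ofReal_zero
    have hcd : ContDiff ℝ ((⊤ : ℕ∞) : WithTop ℕ∞) fun y => ((g y : ℝ) : ℂ) :=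
      Complex.ofRealCLM.contDiff.comp hg
    set θ : 𝓢(E, ℂ) := hcs.toSchwartzMap hcd with hθ
    have hθ_apply : ∀ y, θ y = ((g y : ℝ) : ℂ) := fun y => rfl
    have h1 := integral_smul_complexify_heatExtension_eq_heatSemigroup hU₀ ht hg.continuous hgs θ hθ_apply
    have h2 : (FL : 𝓢'(E, EuclideanSpace ℂ ι)) θ = ∫ x, g x • (FL : E → EuclideanSpace ℂ ι) x := by
      rw [Lp.toTemperedDistribution_apply]
      refine integral_congr_ae (Eventually.of_forall fun x => ?_)
      show θ x • (FL : E → EuclideanSpace ℂ ι) x = _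
      rw [hθ_apply, Complex.coe_smul]
    rw [h1, ← hFL, h2]
  -- `L^p` membership
  have hcvLp : MemLp cv p volume := (Lp.memLp FL).ae_eq hae.symm
  have hvLp : MemLp v p volume := memLp_complexify_comp_iff.1 hcvLp
  refine ⟨?_, hvLp⟩
  have hD := isDistributionOf_toTemperedDistribution hvLp
  have hLp : ((memLp_complexify_comp hvLp).toLp _ : Lp (EuclideanSpace ℂ ι) p (volume : Measure E)) = FL :=
    Lp.ext ((MemLp.coeFn_toLp _).trans hae)
  rw [hLp, hFL] at hD
  exact hD

end Literature.Analysis.FluidPDE
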